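import Literature.NumberTheory.Sieve.RankinSmoothNumbers
import Mathlib.Analysis.SpecialFunctions.Pow.Deriv
import Mathlib.Analysis.SpecialFunctions.Pow.Asymptotics
import Mathlib.Analysis.Calculus.MeanValue
import Mathlib.Analysis.Convex.SpecificFunctions.Basic
import HarnessLib

/-!
# The Hildebrand–Tenenbaum saddle point `α(x, y)` for smooth numbers

Topic `NumberTheory/Sieve` (smooth numbers). The basic objects of the saddle-point method for
`Ψ(x, y)` (Hildebrand–Tenenbaum, *On integers free of large prime factors*, Trans. AMS 296 (1986)
[HildebrandTenenbaum1986], §2; quoted as "Smooth Numbers Result 1" in [Harper2016, §2.1]):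

* `smoothZeta σ y = ζ(σ, y) = ∏_{p ≤ y} (1 - p^{-σ})⁻¹` (`σ > 0`), the generating Dirichlet series of
  the `y`-smooth numbers on the real axis;
* `saddleSum σ y = Σ_{p ≤ y} log p / (p^σ - 1) = -φ₁(σ, y)`, where `φ(s, y) = log ζ(s, y)` and `φ_k`
  is its `k`-th `s`-derivative [HildebrandTenenbaum1986, §2] (`hasDerivAt_log_smoothZeta`);
* `saddlePoint x y = α(x, y)`, "the (unique) solution of the equation `φ₁(α, y) + log x = 0`"
  [HildebrandTenenbaum1986, §2 (2.2)], i.e. of `Σ_{p ≤ y} log p/(p^α - 1) = log x`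
  [Harper2016, §2.1, Smooth Numbers Result 1] — defined for `x > 1`, `y ≥ 2` (junk value `0`
  otherwise), with existence and uniqueness PROVED (`saddleSum` is continuous and strictly decreasing
  on `(0, ∞)`, from `+∞` to `0`): `saddleSum_saddlePoint`, `saddlePoint_pos`, `saddlePoint_unique`,
  and "`α(x, y)` is a decreasing function of `x` for any fixed `y`" [Harper2016, §2.1]
  (`saddlePoint_antitone`);
* Rankin's bound is optimised at `α`: "`Ψ(x, y) ≤ min_{σ > 0} x^σ ζ(σ, y)` … This infimum is in fact
  a minimum, and is attained for `σ = α`" [HildebrandTenenbaum1986, §2 (2.1)–(2.2)]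
  (`rpow_mul_smoothZeta_saddlePoint_le`: `x^α ζ(α, y) ≤ x^σ ζ(σ, y)` for all `σ > 0`, by convexity of
  `σ ↦ σ log x + log ζ(σ, y)`, whose derivative `log x - saddleSum σ y` vanishes exactly at `α`), and
  `card_smoothNumbersUpTo_le_rankin_saddlePoint`: `Ψ(x, y) ≤ x^α ζ(α, y)` (the tree's
  `card_smoothNumbersUpTo_le_rankin`, Montgomery–Vaughan (7.17), at `σ = α`).

NOT here (named for orientation only): the saddle-point asymptotic itself,
`Ψ(x, y) = x^α ζ(α, y)/(α √(2π φ₂(α, y))) (1 + O(1/u + log y / y))` [HildebrandTenenbaum1986, Thm 1],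
and the approximation `α(x, y) = 1 - log(u log(u+1))/log y + O(1/log y)` (`log x < y ≤ x`)
[HildebrandTenenbaum1986, Thm 2 / Lemma 2; Harper2016, (2.1)].

## References

* [HildebrandTenenbaum1986] A. Hildebrand, G. Tenenbaum, Trans. Amer. Math. Soc. 296 (1986)
  265–290, §2, (2.1)–(2.3). Held: `paper:doi-10-1090-s0002-9947-1986-0837811-1` (PDF p. 3).
* [Harper2016] A. J. Harper, Compositio Math. 152 (2016), §2.1 (Smooth Numbers Result 1 and the
  remarks after it). Held: arXiv:1408.1662.
* [MontgomeryVaughan2007] Montgomery–Vaughan, *Multiplicative Number Theory I*, §7.1 (7.17).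
-/

noncomputable section

open Real Filter Finset Topology

namespace Literature.NumberTheory.Sieve

/-! ### `ζ(σ, y)` and `-φ₁(σ, y)` -/

/-- `ζ(σ, y) = ∏_{p ≤ y} (1 - p^{-σ})⁻¹`, the Dirichlet series `Σ_{n y-smooth} n^{-σ}` of the
`y`-smooth numbers at a real point `σ > 0` [HildebrandTenenbaum1986, §1 (1.4)].
[cite: HildebrandTenenbaum1986, §1 (1.4) and §2] -/
def smoothZeta (σ : ℝ) (y : ℕ) : ℝ :=
  ∏ p ∈ Nat.primesLE y, (1 - (p : ℝ) ^ (-σ))⁻¹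

/-- `-φ₁(σ, y) = Σ_{p ≤ y} log p / (p^σ - 1)`, minus the `σ`-derivative of `log ζ(σ, y)`
(`hasDerivAt_log_smoothZeta`); the saddle point `α(x, y)` is where it equals `log x`.
[cite: HildebrandTenenbaum1986, §2 (2.2)] -/
def saddleSum (σ : ℝ) (y : ℕ) : ℝ :=
  ∑ p ∈ Nat.primesLE y, Real.log p / ((p : ℝ) ^ σ - 1)

/-- Unfolding lemma for `smoothZeta`. [folklore] -/
theorem smoothZeta_def (σ : ℝ) (y : ℕ) :
    smoothZeta σ y = ∏ p ∈ Nat.primesLE y, (1 - (p : ℝ) ^ (-σ))⁻¹ := rfl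

/-- Unfolding lemma for `saddleSum`. [folklore] -/
theorem saddleSum_def (σ : ℝ) (y : ℕ) :
    saddleSum σ y = ∑ p ∈ Nat.primesLE y, Real.log p / ((p : ℝ) ^ σ - 1) := rfl

/-- `ζ(σ, y)` in the tree's `Nat.primesBelow` vocabulary: the primes `≤ y` are the primes `< y + 1`.
[folklore] -/
theorem smoothZeta_eq_prod_primesBelow (σ : ℝ) (y : ℕ) :
    smoothZeta σ y = ∏ p ∈ (y + 1).primesBelow, (1 - (p : ℝ) ^ (-σ))⁻¹ := rfl

variable {σ σ₁ σ₂ : ℝ} {y : ℕ} {p : ℕ}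

/-- A prime `≤ y` is at least `2` (as a real number). [folklore] -/
private theorem two_le_of_mem (hp : p ∈ Nat.primesLE y) : (2 : ℝ) ≤ p := by
  exact_mod_cast (Nat.prime_of_mem_primesLE hp).two_le

/-- `p^σ > 1` for a prime `p ≤ y` and `σ > 0`. [folklore] -/
private theorem one_lt_rpow_of_mem (hp : p ∈ Nat.primesLE y) (hσ : 0 < σ) : 1 < (p : ℝ) ^ σ :=
  Real.one_lt_rpow (by linarith [two_le_of_mem hp]) hσ

/-- Each term `log p / (p^σ - 1)` is positive for `σ > 0`. [folklore] -/
theorem saddleSum_term_pos (hp : p ∈ Nat.primesLE y) (hσ : 0 < σ) :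
    0 < Real.log p / ((p : ℝ) ^ σ - 1) :=
  div_pos (Real.log_pos (by linarith [two_le_of_mem hp])) (by linarith [one_lt_rpow_of_mem hp hσ])

/-- `-φ₁(σ, y) > 0` for `σ > 0` and `y ≥ 2`. [folklore] -/
theorem saddleSum_pos (hy : 2 ≤ y) (hσ : 0 < σ) : 0 < saddleSum σ y := by
  have h2 : 2 ∈ Nat.primesLE y := Nat.mem_primesLE.2 ⟨hy, Nat.prime_two⟩
  exact Finset.sum_pos' (fun p hp => (saddleSum_term_pos hp hσ).le) ⟨2, h2, saddleSum_term_pos h2 hσ⟩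

/-- `-φ₁(σ, y) ≥ 0` for `σ > 0`. [folklore] -/
theorem saddleSum_nonneg (hσ : 0 < σ) : 0 ≤ saddleSum σ y :=
  Finset.sum_nonneg fun _ hp => (saddleSum_term_pos hp hσ).le

/-- `ζ(σ, y) > 0` for `σ > 0`. [folklore] -/
theorem smoothZeta_pos (hσ : 0 < σ) : 0 < smoothZeta σ y := by
  refine Finset.prod_pos fun p hp => inv_pos.2 ?_
  have : (p : ℝ) ^ (-σ) < 1 :=
    Real.rpow_lt_one_of_one_lt_of_neg (by linarith [two_le_of_mem hp]) (by linarith)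
  linarith

/-! ### Monotonicity, continuity and limits of `-φ₁(σ, y)` in `σ` -/

/-- Each term `log p / (p^σ - 1)` is strictly decreasing in `σ > 0`. [folklore] -/
theorem saddleSum_term_strictAntiOn (hp : p ∈ Nat.primesLE y) :
    StrictAntiOn (fun σ : ℝ => Real.log p / ((p : ℝ) ^ σ - 1)) (Set.Ioi 0) := by
  intro σ₁ hσ₁ σ₂ _ hlt
  have hp1 : (1 : ℝ) < p := by linarith [two_le_of_mem hp]
  have hlog : 0 < Real.log p := Real.log_pos hp1
  have h1 : 0 < (p : ℝ) ^ σ₁ - 1 := by linarith [one_lt_rpow_of_mem hp (show 0 < σ₁ from hσ₁)]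
  have h12 : (p : ℝ) ^ σ₁ < (p : ℝ) ^ σ₂ := Real.rpow_lt_rpow_of_exponent_lt hp1 hlt
  exact div_lt_div_of_pos_left hlog h1 (by linarith)

/-- `-φ₁(·, y)` is strictly decreasing on `(0, ∞)` (for `y ≥ 2`). [folklore] -/
theorem saddleSum_strictAntiOn (hy : 2 ≤ y) : StrictAntiOn (fun σ : ℝ => saddleSum σ y) (Set.Ioi 0) := by
  intro σ₁ hσ₁ σ₂ hσ₂ hlt
  have h2 : 2 ∈ Nat.primesLE y := Nat.mem_primesLE.2 ⟨hy, Nat.prime_two⟩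
  exact Finset.sum_lt_sum (fun p hp => ((saddleSum_term_strictAntiOn hp) hσ₁ hσ₂ hlt).le)
    ⟨2, h2, (saddleSum_term_strictAntiOn h2) hσ₁ hσ₂ hlt⟩

/-- `-φ₁(·, y)` is weakly decreasing on `(0, ∞)`. [folklore] -/
theorem saddleSum_antitoneOn : AntitoneOn (fun σ : ℝ => saddleSum σ y) (Set.Ioi 0) := by
  intro σ₁ hσ₁ σ₂ hσ₂ hle
  rcases hle.lt_or_eq with hlt | rfl
  · exact Finset.sum_le_sum fun p hp => ((saddleSum_term_strictAntiOn hp) hσ₁ hσ₂ hlt).le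
  · exact le_rfl

/-- `-φ₁(·, y)` is continuous on `(0, ∞)`. [folklore] -/
theorem continuousOn_saddleSum : ContinuousOn (fun σ : ℝ => saddleSum σ y) (Set.Ioi 0) := by
  refine continuousOn_finsetSum _ fun p hp => ?_
  have hp0 : (0 : ℝ) < p := by linarith [two_le_of_mem hp]
  refine ContinuousOn.div continuousOn_const ?_ fun σ hσ => ?_
  · exact ((Real.continuous_const_rpow hp0.ne').sub continuous_const).continuousOn
  · exact (by linarith [one_lt_rpow_of_mem hp (show 0 < σ from hσ)] : (p : ℝ) ^ σ - 1 ≠ 0)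

/-- `-φ₁(σ, y) → 0` as `σ → ∞`. [folklore] -/
theorem tendsto_saddleSum_atTop : Tendsto (fun σ : ℝ => saddleSum σ y) atTop (𝓝 0) := by
  have h : ∀ p ∈ Nat.primesLE y,
      Tendsto (fun σ : ℝ => Real.log p / ((p : ℝ) ^ σ - 1)) atTop (𝓝 0) := by
    intro p hp
    have hp1 : (1 : ℝ) < p := by linarith [two_le_of_mem hp]
    have h1 : Tendsto (fun σ : ℝ => (p : ℝ) ^ σ - 1) atTop atTop :=
      tendsto_atTop_add_const_right _ (-1) (tendsto_rpow_atTop_of_base_gt_one _ hp1)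
    exact tendsto_const_nhds.div_atTop h1
  simpa [saddleSum] using tendsto_finsetSum _ h

/-- `-φ₁(σ, y)` is unbounded as `σ → 0+`: for `0 < σ ≤ 1` the term at `p = 2` alone is
`log 2/(2^σ - 1) ≥ log 2 / σ` (`2^σ ≤ 1 + σ`). [folklore] -/
theorem log_two_div_le_saddleSum (hy : 2 ≤ y) (hσ : 0 < σ) (hσ1 : σ ≤ 1) :
    Real.log 2 / σ ≤ saddleSum σ y := by
  have h2 : 2 ∈ Nat.primesLE y := Nat.mem_primesLE.2 ⟨hy, Nat.prime_two⟩
  have hbern : (2 : ℝ) ^ σ ≤ 1 + σ := by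
    have h := rpow_one_add_le_one_add_mul_self (show (-1 : ℝ) ≤ 1 by norm_num) hσ.le hσ1
    norm_num at h
    linarith
  have hden : 0 < (2 : ℝ) ^ σ - 1 := by
    have := Real.one_lt_rpow (show (1 : ℝ) < 2 by norm_num) hσ
    linarith
  calc Real.log 2 / σ ≤ Real.log 2 / ((2 : ℝ) ^ σ - 1) :=
        div_le_div_of_nonneg_left (Real.log_nonneg one_le_two) hden (by linarith)
    _ = Real.log ((2 : ℕ) : ℝ) / ((((2 : ℕ) : ℝ)) ^ σ - 1) := by norm_num
    _ ≤ saddleSum σ y :=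
        Finset.single_le_sum (f := fun p : ℕ => Real.log p / ((p : ℝ) ^ σ - 1))
          (fun p hp => (saddleSum_term_pos hp hσ).le) h2

/-- **Existence of the saddle point**: for `y ≥ 2` and `L > 0` there is `σ > 0` with
`-φ₁(σ, y) = L` (intermediate value theorem on `(0, ∞)`). [cite: HildebrandTenenbaum1986, §2 (2.2)] -/
theorem exists_saddleSum_eq (hy : 2 ≤ y) {L : ℝ} (hL : 0 < L) :
    ∃ σ : ℝ, 0 < σ ∧ saddleSum σ y = L := by
  -- a small `a` with `saddleSum a y > L`
  set a : ℝ := min 1 (Real.log 2 / (L + 1)) with ha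
  have hlog2 : 0 < Real.log 2 := Real.log_pos one_lt_two
  have ha0 : 0 < a := lt_min one_pos (div_pos hlog2 (by linarith))
  have ha1 : a ≤ 1 := min_le_left _ _
  have haL : L < saddleSum a y := by
    have h1 : Real.log 2 / a ≥ L + 1 := by
      rw [ge_iff_le, le_div_iff₀ ha0]
      calc (L + 1) * a ≤ (L + 1) * (Real.log 2 / (L + 1)) :=
            mul_le_mul_of_nonneg_left (min_le_right _ _) (by linarith)
        _ = Real.log 2 := by field_simp
    linarith [log_two_div_le_saddleSum hy ha0 ha1]
  -- a large `b` with `saddleSum b y < L`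
  obtain ⟨b₀, hb₀⟩ := (tendsto_saddleSum_atTop.eventually (gt_mem_nhds hL)).exists_forall_of_atTop
  set b : ℝ := max b₀ (a + 1) with hb
  have hab : a ≤ b := by rw [hb]; linarith [le_max_right b₀ (a + 1)]
  have hbL : saddleSum b y < L := hb₀ b (le_max_left _ _)
  -- intermediate value theorem on `[a, b] ⊆ (0, ∞)`
  have hcont : ContinuousOn (fun σ : ℝ => saddleSum σ y) (Set.Icc a b) :=
    continuousOn_saddleSum.mono fun σ hσ => lt_of_lt_of_le ha0 hσ.1
  obtain ⟨σ, hσ, hσL⟩ := intermediate_value_Icc' hab hcont ⟨hbL.le, haL.le⟩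
  exact ⟨σ, lt_of_lt_of_le ha0 hσ.1, hσL⟩

/-! ### The saddle point `α(x, y)` -/

/-- **The Hildebrand–Tenenbaum saddle point `α(x, y)`**: for `x > 1` and `y ≥ 2`, the unique
`α > 0` with `Σ_{p ≤ y} log p/(p^α - 1) = log x`, i.e. "the (unique) solution of the equation
`φ₁(α, y) + log x = 0`" [HildebrandTenenbaum1986, (2.2)] = Harper's `α(x, y)` defined by
`Σ_{p ≤ y} log p/(p^α - 1) = log x` [Harper2016, §2.1]. Junk value `0` when `x ≤ 1` or `y < 2`
(then no positive solution exists). [cite: HildebrandTenenbaum1986, §2 (2.2)] -/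
def saddlePoint (x : ℝ) (y : ℕ) : ℝ :=
  if h : 1 < x ∧ 2 ≤ y then (exists_saddleSum_eq h.2 (Real.log_pos h.1)).choose else 0

variable {x x' : ℝ}

/-- `α(x, y) > 0` (`x > 1`, `y ≥ 2`). [cite: HildebrandTenenbaum1986, §2 (2.2)] -/
theorem saddlePoint_pos (hx : 1 < x) (hy : 2 ≤ y) : 0 < saddlePoint x y := by
  rw [saddlePoint, dif_pos ⟨hx, hy⟩]
  exact (exists_saddleSum_eq hy (Real.log_pos hx)).choose_spec.1

/-- **The saddle-point equation**: `Σ_{p ≤ y} log p/(p^α - 1) = log x` at `α = α(x, y)`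
(`x > 1`, `y ≥ 2`). [cite: HildebrandTenenbaum1986, §2 (2.2)] -/
theorem saddleSum_saddlePoint (hx : 1 < x) (hy : 2 ≤ y) :
    saddleSum (saddlePoint x y) y = Real.log x := by
  rw [saddlePoint, dif_pos ⟨hx, hy⟩]
  exact (exists_saddleSum_eq hy (Real.log_pos hx)).choose_spec.2

/-- **Uniqueness of the saddle point**: a positive solution of `Σ_{p ≤ y} log p/(p^σ - 1) = log x`
is `α(x, y)`. [cite: HildebrandTenenbaum1986, §2 (2.2)] -/
theorem saddlePoint_unique (hx : 1 < x) (hy : 2 ≤ y) (hσ : 0 < σ) (h : saddleSum σ y = Real.log x) :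
    σ = saddlePoint x y :=
  (saddleSum_strictAntiOn hy).injOn hσ (saddlePoint_pos hx hy)
    (h.trans (saddleSum_saddlePoint hx hy).symm)

/-- The junk value: `α(x, y) = 0` when `x ≤ 1` or `y < 2`. [folklore] -/
theorem saddlePoint_of_not (h : ¬ (1 < x ∧ 2 ≤ y)) : saddlePoint x y = 0 := by
  rw [saddlePoint, dif_neg h]

/-- **`α(x, y)` is a decreasing function of `x` for fixed `y`** [Harper2016, §2.1, after (2.1)]
(`1 < x ≤ x'`, `y ≥ 2`). [cite: Harper2016, §2.1 (remark after (2.1))] -/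
theorem saddlePoint_antitone (hx : 1 < x) (hxx' : x ≤ x') (hy : 2 ≤ y) :
    saddlePoint x' y ≤ saddlePoint x y := by
  have hx' : 1 < x' := lt_of_lt_of_le hx hxx'
  by_contra hlt
  push Not at hlt
  have h : saddleSum (saddlePoint x' y) y < saddleSum (saddlePoint x y) y :=
    saddleSum_strictAntiOn hy (saddlePoint_pos hx hy) (saddlePoint_pos hx' hy) hlt
  rw [saddleSum_saddlePoint hx hy, saddleSum_saddlePoint hx' hy] at h
  exact absurd (Real.log_le_log (by linarith) hxx') (not_le.2 h)

/-- `α(x, y) < σ` iff `-φ₁(σ, y) < log x`, for `σ > 0` (strict monotonicity). [folklore] -/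
theorem saddlePoint_lt_iff (hx : 1 < x) (hy : 2 ≤ y) (hσ : 0 < σ) :
    saddlePoint x y < σ ↔ saddleSum σ y < Real.log x := by
  rw [← saddleSum_saddlePoint hx hy]
  exact ((saddleSum_strictAntiOn hy).lt_iff_gt hσ (saddlePoint_pos hx hy)).symm

/-! ### `φ₁ = (log ζ)'` and the optimality of `α` in Rankin's bound -/

/-- `log ζ(σ, y) = -Σ_{p ≤ y} log(1 - p^{-σ})` for `σ > 0`. [folklore] -/
theorem log_smoothZeta (hσ : 0 < σ) :
    Real.log (smoothZeta σ y) = ∑ p ∈ Nat.primesLE y, -Real.log (1 - (p : ℝ) ^ (-σ)) := by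
  rw [smoothZeta, Real.log_prod]
  · refine Finset.sum_congr rfl fun p hp => ?_
    rw [Real.log_inv]
  · intro p hp
    have : (p : ℝ) ^ (-σ) < 1 :=
      Real.rpow_lt_one_of_one_lt_of_neg (by linarith [two_le_of_mem hp]) (by linarith)
    exact inv_ne_zero (by linarith)

/-- **`(log ζ(σ, y))' = φ₁(σ, y) = -Σ_{p ≤ y} log p/(p^σ - 1)`** for `σ > 0`.
[cite: HildebrandTenenbaum1986, §2 (definition of φ_k)] -/
theorem hasDerivAt_log_smoothZeta (hσ : 0 < σ) :
    HasDerivAt (fun s : ℝ => Real.log (smoothZeta s y)) (-saddleSum σ y) σ := by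
  -- differentiate `Σ log(1 - p^{-s})` and transfer along `log_smoothZeta` near `σ`
  have hterm : ∀ p ∈ Nat.primesLE y, HasDerivAt (fun s : ℝ => Real.log (1 - (p : ℝ) ^ (-s)))
      (Real.log p / ((p : ℝ) ^ σ - 1)) σ := by
    intro p hp
    have hp0 : (0 : ℝ) < p := by linarith [two_le_of_mem hp]
    have hpσ : 0 < (p : ℝ) ^ σ := Real.rpow_pos_of_pos hp0 σ
    have hlt : (p : ℝ) ^ (-σ) < 1 :=
      Real.rpow_lt_one_of_one_lt_of_neg (by linarith [two_le_of_mem hp]) (by linarith)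
    -- `s ↦ p^{-s}` has derivative `log p · (-1) · p^{-σ}`
    have h1 : HasDerivAt (fun s : ℝ => (p : ℝ) ^ (-s)) (Real.log p * (-1) * (p : ℝ) ^ (-σ)) σ :=
      (hasDerivAt_neg σ).const_rpow hp0
    have h2 : HasDerivAt (fun s : ℝ => 1 - (p : ℝ) ^ (-s))
        (0 - Real.log p * (-1) * (p : ℝ) ^ (-σ)) σ :=
      (hasDerivAt_const σ (1 : ℝ)).fun_sub h1
    have h3 := h2.log (show (1 - (p : ℝ) ^ (-σ)) ≠ 0 by linarith)
    refine h3.congr_deriv ?_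
    rw [Real.rpow_neg hp0.le]
    field_simp
    ring
  have hsum := HasDerivAt.fun_sum (u := Nat.primesLE y) hterm
  have heq : (fun s : ℝ => -(∑ p ∈ Nat.primesLE y, Real.log (1 - (p : ℝ) ^ (-s)))) =ᶠ[𝓝 σ]
      fun s => Real.log (smoothZeta s y) := by
    filter_upwards [lt_mem_nhds hσ] with s hs
    rw [log_smoothZeta hs, Finset.sum_neg_distrib]
  exact (hsum.fun_neg.congr_of_eventuallyEq heq.symm).congr_deriv rfl

/-- **Rankin's bound is minimised at the saddle point**: for every `σ > 0`,
`x^α ζ(α, y) ≤ x^σ ζ(σ, y)` with `α = α(x, y)` (`x > 1`, `y ≥ 2`) — "This infimum is in fact a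
minimum, and is attained for `σ = α`" [HildebrandTenenbaum1986, §2 after (2.1)]. Proof: `g(σ) =
σ log x + log ζ(σ, y)` has derivative `log x + φ₁(σ, y)`, negative on `(0, α)` and positive on
`(α, ∞)`. [cite: HildebrandTenenbaum1986, §2 (2.1)–(2.2)] -/
theorem rpow_mul_smoothZeta_saddlePoint_le (hx : 1 < x) (hy : 2 ≤ y) (hσ : 0 < σ) :
    x ^ saddlePoint x y * smoothZeta (saddlePoint x y) y ≤ x ^ σ * smoothZeta σ y := by
  set α := saddlePoint x y with hαdef
  have hα : 0 < α := saddlePoint_pos hx hy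
  have hx0 : 0 < x := by linarith
  set g : ℝ → ℝ := fun s => s * Real.log x + Real.log (smoothZeta s y) with hg
  -- `g' = log x - saddleSum`
  have hderiv : ∀ s : ℝ, 0 < s → HasDerivAt g (Real.log x - saddleSum s y) s := by
    intro s hs
    have h1 : HasDerivAt (fun s : ℝ => s * Real.log x) (Real.log x) s :=
      hasDerivAt_mul_const (Real.log x)
    exact (h1.fun_add (hasDerivAt_log_smoothZeta (y := y) hs)).congr_deriv (by ring)
  have hdiff : ∀ s : ℝ, 0 < s → DifferentiableAt ℝ g s := fun s hs => (hderiv s hs).differentiableAt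
  have hcont : ContinuousOn g (Set.Ioi 0) := fun s hs => (hdiff s hs).continuousAt.continuousWithinAt
  -- `g α ≤ g σ`
  have hmain : g α ≤ g σ := by
    rcases lt_trichotomy σ α with hlt | rfl | hgt
    · -- on `[σ, α]`, `g' ≤ 0`
      have hanti : AntitoneOn g (Set.Icc σ α) := by
        refine antitoneOn_of_deriv_nonpos (convex_Icc σ α)
          (hcont.mono fun s hs => lt_of_lt_of_le hσ hs.1) ?_ ?_
        · exact fun s hs => (hdiff s (lt_of_lt_of_le hσ (interior_subset hs).1)).differentiableWithinAt
        · intro s hs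
          rw [interior_Icc] at hs
          have hs0 : 0 < s := hσ.trans hs.1
          rw [(hderiv s hs0).deriv, sub_nonpos, ← saddleSum_saddlePoint hx hy]
          exact ((saddleSum_strictAntiOn hy) hs0 hα hs.2).le
      exact hanti ⟨le_rfl, hlt.le⟩ ⟨hlt.le, le_rfl⟩ hlt.le
    · exact le_rfl
    · -- on `[α, σ]`, `g' ≥ 0`
      have hmono : MonotoneOn g (Set.Icc α σ) := by
        refine monotoneOn_of_deriv_nonneg (convex_Icc α σ)
          (hcont.mono fun s hs => lt_of_lt_of_le hα hs.1) ?_ ?_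
        · exact fun s hs => (hdiff s (lt_of_lt_of_le hα (interior_subset hs).1)).differentiableWithinAt
        · intro s hs
          rw [interior_Icc] at hs
          have hs0 : 0 < s := hα.trans hs.1
          rw [(hderiv s hs0).deriv, sub_nonneg, ← saddleSum_saddlePoint hx hy]
          exact ((saddleSum_strictAntiOn hy) hα hs0 hs.1).le
      exact hmono ⟨le_rfl, hgt.le⟩ ⟨hgt.le, le_rfl⟩ hgt.le
  -- exponentiate
  have hexp : ∀ s : ℝ, 0 < s → x ^ s * smoothZeta s y = Real.exp (g s) := by
    intro s hs
    rw [hg]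
    dsimp only
    rw [Real.exp_add, Real.exp_log (smoothZeta_pos hs), Real.rpow_def_of_pos hx0, mul_comm (Real.log x)]
  rw [hexp α hα, hexp σ hσ, Real.exp_le_exp]
  exact hmain

/-- **Rankin's bound at the saddle point**: `Ψ(x, y) ≤ x^α ζ(α, y)`, `α = α(x, y)`, for the count
`#(Nat.smoothNumbersUpTo x (y + 1))` of integers `1 ≤ n ≤ x` with all prime factors `≤ y`
(`x ≥ 2`, `y ≥ 2`) — the tree's `card_smoothNumbersUpTo_le_rankin` (Montgomery–Vaughan (7.17)) at
`σ = α`, i.e. [HildebrandTenenbaum1986, (2.1)] with the optimal exponent.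
[cite: HildebrandTenenbaum1986, §2 (2.1)] -/
theorem card_smoothNumbersUpTo_le_rankin_saddlePoint {x : ℕ} (hx : 2 ≤ x) (hy : 2 ≤ y) :
    ((Nat.smoothNumbersUpTo x (y + 1)).card : ℝ) ≤
      (x : ℝ) ^ saddlePoint x y * smoothZeta (saddlePoint x y) y := by
  have hx1 : (1 : ℝ) < x := by exact_mod_cast (lt_of_lt_of_le one_lt_two hx)
  rw [smoothZeta_eq_prod_primesBelow]
  exact card_smoothNumbersUpTo_le_rankin x (y + 1) (saddlePoint_pos hx1 hy)


/-! ### A worked example: `y = 2` -/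

/-- For `y = 2` the only prime is `2` and `-φ₁(σ, 2) = log 2/(2^σ - 1)`. [folklore] -/
theorem saddleSum_two (σ : ℝ) : saddleSum σ 2 = Real.log 2 / ((2 : ℝ) ^ σ - 1) := by
  have h : Nat.primesLE 2 = {2} := by decide
  rw [saddleSum, h, Finset.sum_singleton]
  norm_num

/-- **Worked example** (non-vacuity of `saddlePoint`): `α(x, 2) = log₂(1 + log 2 / log x)` for
`x > 1`, the exact solution of `log 2/(2^α - 1) = log x` (compare `α(x, y) ≈ log(1 + y/log x)/log y`,
[HildebrandTenenbaum1986, Thm 2 (2.4)]). [folklore] -/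
theorem saddlePoint_two (hx : 1 < x) :
    saddlePoint x 2 = Real.logb 2 (1 + Real.log 2 / Real.log x) := by
  have hlogx : 0 < Real.log x := Real.log_pos hx
  have hlog2 : 0 < Real.log 2 := Real.log_pos one_lt_two
  have hq : 1 < 1 + Real.log 2 / Real.log x := by
    have := div_pos hlog2 hlogx; linarith
  set α : ℝ := Real.logb 2 (1 + Real.log 2 / Real.log x) with hα
  have hα0 : 0 < α := Real.logb_pos one_lt_two hq
  have h2α : (2 : ℝ) ^ α = 1 + Real.log 2 / Real.log x := by
    rw [hα, Real.rpow_logb two_pos (by norm_num) (by linarith)]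
  symm
  refine saddlePoint_unique hx le_rfl hα0 ?_
  rw [saddleSum_two, h2α, add_sub_cancel_left]
  field_simp

end Literature.NumberTheory.Sieve

end
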